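import Mathlib
import Summits.HodgeConjecture.FermatCycles.HodgeFermatPropDPrimeNB
import Summits.HodgeConjecture.FermatCycles.HodgeFermatDescentBStatement

/-!
# THE DESCENT AT THE LEVELS 15N AND 21N — §13.1 of DPRIME in the kernel — part 1: (JP), level facts, the THEOREM-F* branch, the descent at `15N` (`HodgeFermat/DescentB.lean`; HF-G34b)

Tree copy (part 1 of 2) of the module `HodgeFermat/DescentB.lean` of the sibling cell's standalone package
`run/shared/lean/pub/pub-hodgefermat/lean/HodgeFermat/` (453 lines, sha256 `bcd014a39d36c708…`), source lines 42–245 (§§0–2: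
`big15_sub`, `big21_sub`, `classes15_share`, `classes21_share`, `squarefree_mul_prime`, `level_facts`, `primeFactors_of_dvd`,
`fstar_branch`, `descent15`, `noCoincidence15`); part 2 = `HodgeFermatDescentBB.lean` (§§3–5).
Filed by cell `pub-hfermat`, seat prover-1 gen-4, on the COORDINATOR KEEPER RULING of 2026-08-25 (gem sweep H1: take the
off-gate kernel theorem `thmFstar` through the gate).  The three forms of THEOREM F* named `thmFstar` in the sibling package are
on-gate since 2026-08-25/26 (`HodgeFermatThmFstar.lean` = F* at the prime levels, HF-G32, seat gen-0; `HodgeFermatThmFstarN.lean` =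
F*(3N), HF-G33, gen-2; `HodgeFermatPropDPrimeNFinal.lean` = PROPOSITION D′(3N) and THE DESCENT, HF-G34, gen-3); this generation
files the two remaining off-gate companions of that family: PROPOSITION D′ at the prime levels (the second theorem of the HF-G32
gate record itself, `DecodingDPrime` / `DPrimePrimeFinal`) and THE DESCENT AT THE LEVELS 15N AND 21N (HF-G34b, `DescentB` /
`DescentBFinal`).
The source module is the sibling's hub-checked module of record (pub-hodgefermat `CERT.md` l.993 / `GATE.md` l.2063, GATE HF-G34b,
verdict GREEN; records: the split pair `check/DescentB_link_standalone.lean` sha256 `616bf184267f3ed3…` rc 0, `--axioms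
…DescentB.descent15` / `…descent21` = [propext, Classical.choice, Quot.sound] + exactly the admitted one-line kernel certificate
`CoincFull.fullCheck_39`, which is PROVED (`decide +kernel`, axioms []) in `check/DecodingDPrime_part1_standalone.lean` sha256
`e147557e91070793…` rc 0 and landed in `HodgeFermatCoincFullK.lean`); its declarations are copied VERBATIM.
Deviations from the source module, exhaustively: the `import` lines (tree modules `Summits.HodgeConjecture.FermatCycles.HodgeFermat*`
instead of `HodgeFermat.*`: `…HodgeFermatPropDPrimeNB` for `import HodgeFermat.PropDPrimeN`); this module docstring (the source's
copyright comment l.1–3 and module docstring l.6–40 are quoted below); the three definitions `JP`, `big15`, `big21` (source l.55–76)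
are NOT repeated here — they are declared, verbatim and in this namespace, in the statement file `HodgeFermatDescentBStatement.lean`
(imported; filed first, count-neutral); one-line docstrings added (gate lint) to `big15_sub`, `big21_sub`, `squarefree_mul_prime`;
the file ends at source l.245 with an `end` line (part 2 = `HodgeFermatDescentBB.lean`).
Every other line — in particular every declaration's statement and proof — is byte-identical to the source.
Trust base of this part: `descent15` / `noCoincidence15` carry the source's named hypotheses `KR6'`, `ThmUPlus'`, `Fstar` (all three
THEOREMS of the tree, discharged in `HodgeFermatDescentBFinal.lean`) and `JP 15` (= (JP₁₅), NOT proved anywhere: THEOREM F15⁺'s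
analytic half); no `sorry`; axioms = [propext, Classical.choice, Quot.sound].
HONEST FRAMING: explicit algebraic cycles for specific Hodge classes on Fermat/Delsarte varieties; residual open instances
listed; no claim on general Hodge.  (This file is arithmetic of CM types / finite combinatorics of the sibling's KR-free
programme; it claims nothing about cycles.)

The source module's copyright comment (l.1–3: its one line of text) and docstring (l.6–40), verbatim:

Copyright: pub-hodgefermat build (speedrun `hodge-fermat`), generation 34 (second gate), 2026-08-22.

## THE DESCENT AT THE LEVELS 15N AND 21N — §13.1 of `tables/DPRIME-THEOREM.md` in the kernel (HF-G34b)

THEOREM F15⁺/F21⁺ (`tables/DPRIME-THEOREM.md` §13): at every squarefree level `m = m₀·m₁`, `m₀ ∈ {15, 21}`, all primes of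
`m₁ ≥ 11`, every DISJOINT coincidence of CM types has reduced level in `B = {15, 21, 39}`.  §13.1 reduces this to the
statement

  **(JP_m₀)** for every squarefree `m₁ > 1` with all primes `≥ 11` there is no disjoint JOINTLY PRIMITIVE coincidence of
  level `m₀·m₁`,

whose proof (§13.2–13.4: the componentwise uncertainty certificate PROPOSITION P″, LEMMA U″, the decoding over `(ℤ/m₁)ˣ`)
is the analytic half and is NOT in the kernel.  This light module (it imports `PropDPrimeN` only) proves the reduction
§13.1 itself, with `(JP_m₀)` as the named hypothesis `JP m₀` next to `KR6'`, `ThmUPlus'` and THEOREM F\*(3N) (`Fstar`,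
a theorem: `ThmFstarNFinal.thmFstar`):

* `descent15` / `descent21` — for `N > 0` squarefree with all primes `≥ 11`, two zero-sum triples mod `15N` (resp. `21N`) with
  no entry `≡ 0`, DISJOINT, of the same CM type, are EITHER `5N/13` (resp. `7N/13`) times one of the twelve level-39 unit pairs
  (`PropDPrimeN.units39`; then `13 ∣ N`) OR `N` times a pair from one of the two six-element classes `big15` of the complete
  level-15 list `CoincFull.classes15` (resp. `big21` ⊂ `CoincFull.classes21`) — reduced level `39` or `15` (resp. `21`).
  Proof: `g :=` the gcd of the level and the entries (`PropDPrimeN.exists_gcd`), `PropDPrimeN.reduce` to the jointly primitive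
  pair at level `ℓ = 15N/g`; COROLLARY M (`ThreeFinal.corollaryM_final`): `3 ∣ ℓ`, `ℓ = 3ℓ′`, `ℓ′ ∣ 5N`; if `5 ∤ ℓ′` then `ℓ′ ∣ N`
  and THE DESCENT of generation 34 (`PropDPrimeN.descent`, i.e. THEOREM F\*) together with joint primitivity forces `ℓ′ = 13`
  and a unit pair (`fstar_branch`); if `5 ∣ ℓ′` then `ℓ = 15ℓ₁`, `ℓ₁ ∣ N`: `ℓ₁ = 1` is the complete level-15 list
  `CoincFull.fullAt_15` (its `Perm3` alternative and the twelve classes outside `big15` — pairwise entry-sharing,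
  `classes15_share`, `decide` — contradict disjointness), and `ℓ₁ > 1` is excluded by `(JP₁₅)`.
* `noCoincidence15` / `noCoincidence21` — if `13 ∤ N`, every disjoint coincidence at level `15N` (`21N`) is `N` times a
  level-15 (level-21) pair.
* THE CONVERSES `big15_lift` / `big21_lift` (hypothesis-free): `g` times a DISJOINT pair of one class of `big15` (`big21`) is a
  disjoint coincidence at level `15g` (`21g`); and `units39_lift15` / `units39_lift21`: `5g`/`7g` times a level-39 unit pair is
  one at level `15·(13g)` / `21·(13g)` (`PropDPrimeN.units39_lift`).  So the descriptions are exact.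
* `not_JP_three` — the shape of the hypothesis is level-sensitive: `JP 3` is FALSE (level `39 = 3·13` carries the disjoint
  jointly primitive unit pairs), while `JP 15`, `JP 21` are THEOREM F15⁺/F21⁺'s content (JP).

Records: `check/DescentB_link_standalone.lean` (split pair with gen 32's `DecodingDPrime_part1_standalone.lean`); `GATE.md` § HF-G34b.
-/

set_option autoImplicit false

namespace HodgeFermat.KRFree.DescentB

open HodgeFermat.KRFree.LemmaN
open HodgeFermat.KRFree.TheoremUEq (ThmUPlus' Perm3)
open HodgeFermat.KRFree.TheoremZ3U (KR6')
open HodgeFermat.KRFree.CoincFull (classes15 classes21 classes39 InClass fullAt_15 fullAt_21)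
open HodgeFermat.KRFree.PropDPrimeN (Fstar units39 Share exists_gcd reduce perm3_modEq share_common perm3_mem
  not_dvd_of_primeFactors eleven_le)

/-! ## 0. The hypothesis (JP_m₀) and the two big classes at 15 and 21 -/

-- `JP`, `big15`, `big21` (source l.55–76): declared verbatim in `HodgeFermatDescentBStatement.lean` (this namespace), imported.

/-- `big15 ⊆ classes15` -/
theorem big15_sub : ∀ cl ∈ big15, cl ∈ classes15 := by decide

/-- `big21 ⊆ classes21` -/
theorem big21_sub : ∀ cl ∈ big21, cl ∈ classes21 := by decide

/-- kernel check: in every class of `classes15` other than the two of `big15` any two members share an entry -/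
theorem classes15_share : ∀ cl ∈ classes15, cl ∉ big15 → ∀ T ∈ cl, ∀ T' ∈ cl, Share T T' := by decide

/-- kernel check: in every class of `classes21` other than the two of `big21` any two members share an entry -/
theorem classes21_share : ∀ cl ∈ classes21, cl ∉ big21 → ∀ T ∈ cl, ∀ T' ∈ cl, Share T T' := by decide

/-! ## 1. Level facts and the THEOREM-F\* branch -/

/-- `p·N` is squarefree for a prime `p ∤ N` and squarefree `N` -/
lemma squarefree_mul_prime {p N : ℕ} (hp : p.Prime) (hpN : ¬ p ∣ N) (hsq : Squarefree N) :
    Squarefree (p * N) :=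
  (Nat.squarefree_mul ((Nat.Prime.coprime_iff_not_dvd hp).mpr hpN)).mpr ⟨hp.squarefree, hsq⟩

/-- `15N` and `21N` are squarefree and odd -/
lemma level_facts {N : ℕ} (hN : 0 < N) (hsq : Squarefree N) (h11 : ∀ p ∈ N.primeFactors, 11 ≤ p) :
    (Squarefree (15 * N) ∧ Odd (15 * N)) ∧ (Squarefree (21 * N) ∧ Odd (21 * N)) := by
  have h2 := not_dvd_of_primeFactors hN h11 Nat.prime_two (by norm_num)
  have h3 := not_dvd_of_primeFactors hN h11 Nat.prime_three (by norm_num)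
  have h5 := not_dvd_of_primeFactors hN h11 Nat.prime_five (by norm_num)
  have h7 := not_dvd_of_primeFactors hN h11 (by norm_num : Nat.Prime 7) (by norm_num)
  have hodd : Odd N := Nat.odd_iff.mpr (by omega)
  have s5 : Squarefree (5 * N) := squarefree_mul_prime Nat.prime_five h5 hsq
  have s7 : Squarefree (7 * N) := squarefree_mul_prime (by norm_num) h7 hsq
  have h35 : ¬ 3 ∣ 5 * N := fun h => by
    rcases (Nat.Prime.dvd_mul Nat.prime_three).mp h with h | h
    · omega
    · exact h3 h
  have h37 : ¬ 3 ∣ 7 * N := fun h => by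
    rcases (Nat.Prime.dvd_mul Nat.prime_three).mp h with h | h
    · omega
    · exact h3 h
  refine ⟨⟨?_, ?_⟩, ⟨?_, ?_⟩⟩
  · rw [show 15 * N = 3 * (5 * N) by ring]; exact squarefree_mul_prime Nat.prime_three h35 s5
  · exact Nat.odd_mul.mpr ⟨by decide, hodd⟩
  · rw [show 21 * N = 3 * (7 * N) by ring]; exact squarefree_mul_prime Nat.prime_three h37 s7
  · exact Nat.odd_mul.mpr ⟨by decide, hodd⟩

/-- divisors of `N` inherit "all primes `≥ 11`" -/
lemma primeFactors_of_dvd {N ℓ : ℕ} (hN : 0 < N) (h11 : ∀ p ∈ N.primeFactors, 11 ≤ p) (hℓ : ℓ ∣ N) :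
    ∀ p ∈ ℓ.primeFactors, 11 ≤ p := fun p hp =>
  h11 p (Nat.mem_primeFactors.mpr ⟨Nat.prime_of_mem_primeFactors hp, (Nat.dvd_of_mem_primeFactors hp).trans hℓ, hN.ne'⟩)

/-- **the THEOREM-F\* branch**: a disjoint JOINTLY PRIMITIVE coincidence at a level `3ℓ₁` with `ℓ₁ ∣ N` (so `ℓ₁` squarefree, all
primes `≥ 11`) has `ℓ₁ = 13` and lies in one of the two unit classes mod `39` — THE DESCENT of generation 34 plus primitivity. -/
lemma fstar_branch (hKR : KR6') (hUplus : ThmUPlus') (hF : Fstar) {N : ℕ} (hN : 0 < N) (hsq : Squarefree N)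
    (h11 : ∀ p ∈ N.primeFactors, 11 ≤ p) {ℓ₁ : ℕ} (hℓ₁N : ℓ₁ ∣ N) {a b c a' b' c' : ℕ}
    (hs : 3 * ℓ₁ ∣ a + b + c) (ha : ¬ 3 * ℓ₁ ∣ a) (hb : ¬ 3 * ℓ₁ ∣ b) (hc : ¬ 3 * ℓ₁ ∣ c)
    (hs' : 3 * ℓ₁ ∣ a' + b' + c') (ha' : ¬ 3 * ℓ₁ ∣ a') (hb' : ¬ 3 * ℓ₁ ∣ b') (hc' : ¬ 3 * ℓ₁ ∣ c')
    (hJ : ∀ q, Nat.Prime q → q ∣ 3 * ℓ₁ → q ∣ a → q ∣ b → q ∣ c → q ∣ a' → q ∣ b' → q ∣ c' → False)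
    (hD : ∀ u v, (u = a ∨ u = b ∨ u = c) → (v = a' ∨ v = b' ∨ v = c') → ¬ u ≡ v [MOD 3 * ℓ₁])
    (hH : SameType (3 * ℓ₁) (a, b, c) (a', b', c')) :
    ℓ₁ = 13 ∧ ∃ cl ∈ units39, InClass cl (a % 39) (b % 39) (c % 39) ∧ InClass cl (a' % 39) (b' % 39) (c' % 39) := by
  have hℓ₁ : 0 < ℓ₁ := Nat.pos_of_dvd_of_pos hℓ₁N hN
  obtain ⟨g, hg13, ga, gb, gc, ga', gb', gc', cl, hcl, hT, hT'⟩ :=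
    PropDPrimeN.descent hKR hUplus hF hℓ₁ (hsq.squarefree_of_dvd hℓ₁N) (primeFactors_of_dvd hN h11 hℓ₁N)
      hs ha hb hc hs' ha' hb' hc' hD hH
  have hg1 : g = 1 := by
    by_contra hne
    obtain ⟨q, hq, hqg⟩ := Nat.exists_prime_and_dvd hne
    exact hJ q hq (by rw [hg13, ← mul_assoc]; exact hqg.mul_left _) (hqg.trans ga) (hqg.trans gb)
      (hqg.trans gc) (hqg.trans ga') (hqg.trans gb') (hqg.trans gc')
  subst hg1
  refine ⟨by omega, cl, hcl, ?_, ?_⟩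
  · simpa only [Nat.div_one] using hT
  · simpa only [Nat.div_one] using hT'

/-! ## 2. The descent at the levels 15N -/

/-- **THE DESCENT AT LEVEL 15N** (under `KR6'`, `ThmUPlus'`, `Fstar` and `(JP₁₅)`).  `N > 0` squarefree, all primes `≥ 11`;
two zero-sum triples mod `15N`, no entry `≡ 0 (mod 15N)`, DISJOINT mod `15N`, same CM type.  Then EITHER `N = 13·g` with `5g`
dividing all six entries and the pair reduced by `5g` in one of the two unit classes mod `39` (reduced level `39`), OR `N` divides
all six entries and the pair reduced by `N` lies in one of the two big classes mod `15` (reduced level `15`). -/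
theorem descent15 (hKR : KR6') (hUplus : ThmUPlus') (hF : Fstar) (hJP : JP 15) {N : ℕ} (hN : 0 < N)
    (hsq : Squarefree N) (h11 : ∀ p ∈ N.primeFactors, 11 ≤ p) {a b c a' b' c' : ℕ}
    (hs : 15 * N ∣ a + b + c) (ha : ¬ 15 * N ∣ a) (hb : ¬ 15 * N ∣ b) (hc : ¬ 15 * N ∣ c)
    (hs' : 15 * N ∣ a' + b' + c') (ha' : ¬ 15 * N ∣ a') (hb' : ¬ 15 * N ∣ b') (hc' : ¬ 15 * N ∣ c')
    (hD : ∀ u v, (u = a ∨ u = b ∨ u = c) → (v = a' ∨ v = b' ∨ v = c') → ¬ u ≡ v [MOD 15 * N])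
    (hH : SameType (15 * N) (a, b, c) (a', b', c')) :
    (∃ g, N = 13 * g ∧ 5 * g ∣ a ∧ 5 * g ∣ b ∧ 5 * g ∣ c ∧ 5 * g ∣ a' ∧ 5 * g ∣ b' ∧ 5 * g ∣ c' ∧
      ∃ cl ∈ units39, InClass cl (a / (5 * g) % 39) (b / (5 * g) % 39) (c / (5 * g) % 39) ∧
        InClass cl (a' / (5 * g) % 39) (b' / (5 * g) % 39) (c' / (5 * g) % 39)) ∨
    (N ∣ a ∧ N ∣ b ∧ N ∣ c ∧ N ∣ a' ∧ N ∣ b' ∧ N ∣ c' ∧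
      ∃ cl ∈ big15, InClass cl (a / N % 15) (b / N % 15) (c / N % 15) ∧
        InClass cl (a' / N % 15) (b' / N % 15) (c' / N % 15)) := by
  obtain ⟨⟨hsqL, hoddL⟩, -⟩ := level_facts hN hsq h11
  obtain ⟨g, hgM, ⟨a₁, rfl⟩, ⟨b₁, rfl⟩, ⟨c₁, rfl⟩, ⟨a₂, rfl⟩, ⟨b₂, rfl⟩, ⟨c₂, rfl⟩, hmax⟩ :=
    exists_gcd (15 * N) a b c a' b' c'
  obtain ⟨ℓ, hℓ⟩ := hgM
  have hg : 0 < g := Nat.pos_of_ne_zero (by rintro rfl; omega)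
  have hℓpos : 0 < ℓ := Nat.pos_of_ne_zero (by rintro rfl; omega)
  have hℓdvd : ℓ ∣ 15 * N := ⟨g, by rw [hℓ, mul_comm]⟩
  rw [hℓ] at hs ha hb hc hs' ha' hb' hc' hD hH
  obtain ⟨hs₁, ha₁, hb₁, hc₁, hs₂, ha₂, hb₂, hc₂, hD₁, hH₁⟩ := reduce hg hℓpos hs ha hb hc hs' ha' hb' hc' hD hH
  -- the reduced pair is jointly primitive at level ℓ (maximality of g)
  have hJ₁ : ∀ q, Nat.Prime q → q ∣ ℓ → q ∣ a₁ → q ∣ b₁ → q ∣ c₁ → q ∣ a₂ → q ∣ b₂ → q ∣ c₂ → False := by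
    intro q hq hqℓ qa qb qc qa' qb' qc'
    have hdvd : g * q ∣ g := hmax (g * q) (by rw [hℓ]; exact Nat.mul_dvd_mul_left g hqℓ)
      (Nat.mul_dvd_mul_left g qa) (Nat.mul_dvd_mul_left g qb) (Nat.mul_dvd_mul_left g qc)
      (Nat.mul_dvd_mul_left g qa') (Nat.mul_dvd_mul_left g qb') (Nat.mul_dvd_mul_left g qc')
    have h1 := Nat.le_of_dvd hg hdvd
    have h2 := Nat.mul_le_mul_left g hq.two_le
    omega
  -- COROLLARY M at the squarefree odd level ℓ: 3 ∣ ℓ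
  obtain ⟨⟨ℓ', rfl⟩, -⟩ := ThreeFinal.corollaryM_final hKR hUplus ℓ a₁ b₁ c₁ a₂ b₂ c₂
    (hsqL.squarefree_of_dvd hℓdvd) (hoddL.of_dvd_nat hℓdvd) hs₁ ha₁ hb₁ hc₁ hs₂ ha₂ hb₂ hc₂ hJ₁ hD₁ hH₁
  by_cases h5 : 5 ∣ ℓ'
  · -- reduced level 15ℓ₁
    obtain ⟨ℓ₁, rfl⟩ := h5
    have e : 3 * (5 * ℓ₁) = 15 * ℓ₁ := by ring
    rw [e] at hs₁ ha₁ hb₁ hc₁ hs₂ ha₂ hb₂ hc₂ hD₁ hH₁ hJ₁ hℓdvd hℓ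
    have hℓ₁N : ℓ₁ ∣ N := Nat.dvd_of_mul_dvd_mul_left (by norm_num : 0 < 15) hℓdvd
    have hℓ₁ : 0 < ℓ₁ := Nat.pos_of_dvd_of_pos hℓ₁N hN
    by_cases h1 : ℓ₁ = 1
    · -- level 15: the complete list
      subst h1
      right
      have hgN : g = N := by omega
      subst hgN
      refine ⟨Dvd.intro _ rfl, Dvd.intro _ rfl, Dvd.intro _ rfl, Dvd.intro _ rfl, Dvd.intro _ rfl, Dvd.intro _ rfl, ?_⟩
      simp only [Nat.mul_div_cancel_left _ hg]
      have e15 : (15 : ℕ) * 1 = 15 := rfl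
      rw [e15] at hs₁ ha₁ hb₁ hc₁ hs₂ ha₂ hb₂ hc₂ hD₁ hH₁
      rcases fullAt_15 a₁ b₁ c₁ a₂ b₂ c₂ ha₁ hb₁ hc₁ ha₂ hb₂ hc₂ hs₁ hs₂ hH₁ with hP | ⟨cl, hcl, hT, hT'⟩
      · obtain ⟨v, hv, hav⟩ := perm3_modEq hP
        exact absurd hav (hD₁ a₁ v (Or.inl rfl) hv)
      · refine ⟨cl, ?_, hT, hT'⟩
        by_contra hu
        obtain ⟨T, hTcl, hpT⟩ := hT
        obtain ⟨T', hT'cl, hpT'⟩ := hT'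
        obtain ⟨w, hw, hw'⟩ := share_common (classes15_share cl hcl hu T hTcl T' hT'cl)
        rcases perm3_mem hpT hw with rfl | rfl | rfl <;> rcases perm3_mem hpT' hw' with h | h | h
        all_goals exact hD₁ _ _ (by simp) (by simp) h
    · -- level 15ℓ₁, ℓ₁ > 1: (JP₁₅)
      exfalso
      exact hJP ℓ₁ a₁ b₁ c₁ a₂ b₂ c₂ (by omega) (hsq.squarefree_of_dvd hℓ₁N) (primeFactors_of_dvd hN h11 hℓ₁N)
        hs₁ ha₁ hb₁ hc₁ hs₂ ha₂ hb₂ hc₂ hJ₁ hD₁ hH₁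
  · -- reduced level 3ℓ' with 5 ∤ ℓ': ℓ' ∣ N, the THEOREM-F* branch
    have hℓ'5N : ℓ' ∣ 5 * N :=
      Nat.dvd_of_mul_dvd_mul_left (by norm_num : 0 < 3) (by rwa [show 15 * N = 3 * (5 * N) by ring] at hℓdvd)
    have hcop : Nat.Coprime ℓ' 5 := (Nat.Coprime.symm ((Nat.Prime.coprime_iff_not_dvd Nat.prime_five).mpr h5))
    have hℓ'N : ℓ' ∣ N := hcop.dvd_of_dvd_mul_left hℓ'5N
    obtain ⟨h13, cl, hcl, hT, hT'⟩ := fstar_branch hKR hUplus hF hN hsq h11 hℓ'N hs₁ ha₁ hb₁ hc₁ hs₂ ha₂ hb₂ hc₂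
      hJ₁ hD₁ hH₁
    subst h13
    left
    have h5g : 5 ∣ g := by omega
    obtain ⟨g₀, rfl⟩ := h5g
    refine ⟨g₀, by omega, Dvd.intro _ rfl, Dvd.intro _ rfl, Dvd.intro _ rfl, Dvd.intro _ rfl, Dvd.intro _ rfl,
      Dvd.intro _ rfl, ?_⟩
    simp only [Nat.mul_div_cancel_left _ hg]
    exact ⟨cl, hcl, hT, hT'⟩

/-- **COROLLARY.**  If `13 ∤ N`, every disjoint coincidence at level `15N` is `N` times a level-15 pair of a big class. -/
theorem noCoincidence15 (hKR : KR6') (hUplus : ThmUPlus') (hF : Fstar) (hJP : JP 15) {N : ℕ} (hN : 0 < N)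
    (hsq : Squarefree N) (h11 : ∀ p ∈ N.primeFactors, 11 ≤ p) (h13 : ¬ 13 ∣ N) {a b c a' b' c' : ℕ}
    (hs : 15 * N ∣ a + b + c) (ha : ¬ 15 * N ∣ a) (hb : ¬ 15 * N ∣ b) (hc : ¬ 15 * N ∣ c)
    (hs' : 15 * N ∣ a' + b' + c') (ha' : ¬ 15 * N ∣ a') (hb' : ¬ 15 * N ∣ b') (hc' : ¬ 15 * N ∣ c')
    (hD : ∀ u v, (u = a ∨ u = b ∨ u = c) → (v = a' ∨ v = b' ∨ v = c') → ¬ u ≡ v [MOD 15 * N])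
    (hH : SameType (15 * N) (a, b, c) (a', b', c')) :
    N ∣ a ∧ N ∣ b ∧ N ∣ c ∧ N ∣ a' ∧ N ∣ b' ∧ N ∣ c' ∧
      ∃ cl ∈ big15, InClass cl (a / N % 15) (b / N % 15) (c / N % 15) ∧
        InClass cl (a' / N % 15) (b' / N % 15) (c' / N % 15) := by
  rcases descent15 hKR hUplus hF hJP hN hsq h11 hs ha hb hc hs' ha' hb' hc' hD hH with ⟨g, hg, -⟩ | h
  · exact absurd ⟨g, hg⟩ h13
  · exact h

end HodgeFermat.KRFree.DescentB
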